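/-
Origin: expansion seat `prover-pub-hodgecm-mc-carch-1-g36-0`, handover #CA65 2026-08-21T00:41Z md5 9d283c3f05fb (170 l.; NEW additive leaf; imports Model.ArchKTypeOfMultOne (#CA64, same kit) + Model.AdelicThetaDistributionMultEnd (#R124, RUN 67); ns HodgeCM.Model.ThetaAdelicSide; 4 theorems 0 defs; ROWDEP on #CA64; NAMES for audit: HodgeCM.Model.ThetaAdelicSide.rank_admFamilies_thetaDistDatumZeroOf_le_one · HodgeCM.Model.ThetaAdelicSide.rank_admFamilies_thetaDistDatumOneOf_le_one · HodgeCM.Model.ThetaAdelicSide.clsU_mem_iSup_block_of_mem_holSat_archSideOf_zero_of_ne_zero) (`HOME/mc/pub-hodgecm-mc-carch-1/stage68/HodgeCM/Model/ArchKTypeOfMultOneDatum.lean`, md5 9d283c3f05fb, 170 lines);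
landed by the second packager p2 gen 16 (p2-g16) in gate run 68 as `HodgeCM/Model/ArchKTypeOfMultOneDatum.lean` (verbatim).
-/
/-
Copyright (c) 2026 the pub-hodgecm formalisation cell (harness21).  New file, not vendored.
Origin: session prover-pub-hodgecm-mc-carch-1-g36-0 (unit pub-hodgecm-mc-carch-1, C / ARCHDATUM BUILDER gen 36; (J4-mult1) DISCHARGED BY NAME at
the honest (J4) product Weil data of slots 0/1), 2026-08-21.
Intended final place: `HodgeCM/Model/ArchKTypeOfMultOneDatum.lean` (NEW additive model-layer leaf; imports carch #CA64 `Model/ArchKTypeOfMultOne` +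
binder-1 #R124 `Model/AdelicThetaDistributionMultEnd` (RUN 67); nothing imports it; drop alone).
-/
import Summits.HodgeConjecture.HodgeCM.Model.ArchKTypeOfMultOne_2
import Summits.HodgeConjecture.HodgeCM.Model.AdelicThetaDistributionMultEnd

set_option autoImplicit false

/-!
# (J4-mult1) discharged BY NAME: `hrk` for `thetaDistDatumZeroOf/OneOf … .admFamilies (archOpZero/One …)`

Binder-1's #R124 `clsU_mem_iSup_block_of_mem_holSat_archSideOf_zero/one_of_rank_le_one` takes the multiplicity-one input in RANK form
`hrk : Module.rank ℂ ↥((thetaDistDatumZeroOf … Φ₀ harm₀ hdef₀).admFamilies (archOpZero …)) ≤ 1`.  By #CA64 `rank_le_one_of_lineOmega_zero/one`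
(`D.ωA = lineOmega_k …` and `((archSideOf …).P k).ω = lineRepOf … k` by `rfl`, `har` = #R124 `archSideOf_ω_zero/one_regime_archToAdelic`) that
hypothesis is a THEOREM for EVERY `(Φ₀, harm₀, hdef₀)`:

* `rank_admFamilies_thetaDistDatumZeroOf_le_one`, `rank_admFamilies_thetaDistDatumOneOf_le_one` — `hrk`, kernel;
* `clsU_mem_iSup_block_of_mem_holSat_archSideOf_zero/one_of_ne_zero` — #R124's end statements with `hrk` struck: the `U`-level class of
  EVERY saturated hol-germ theta form of slots 0/1 of the honest side lies in the supremum of the coinvariant blocks, given only `Φarch ≠ 0`,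
  the slot's (a4)/(a5) differentiability inputs `hd`/`hCR` (#CA62) and `h𝓕`/`hι`.

KERNEL only: 0 defs, 0 records, nothing cited; `#print axioms` ⊆ {propext, Classical.choice, Quot.sound}.
-/

noncomputable section

open MeasureTheory MulAction IsDedekindDomain NumberField.mixedEmbedding
open NumberField hiding relNormOneIdeles relNormOneRat probHaarRelNormOneQuot
open scoped Matrix TensorProduct Classical SchwartzMap
open Literature.NumberTheory.Automorphic Literature.NumberTheory.Automorphic.UnitaryGroup Literature.NumberTheory.Weil1964
open Literature.NumberTheory.GelbartRogawski1991 Literature.NumberTheory.GelbartRogawski1991.UnitaryDualPair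
open Literature.Geometry.ComplexHyperbolic.BallModel (U21 x₀)
open Literature.AlgebraicGeometry.HodgeTheory Literature.AlgebraicGeometry.ShimuraVarieties
open Literature.NumberTheory.Automorphic.PicardCM
open Literature.NumberTheory.Transcendental (Arapura2012_Cor_15_4_6)
open HodgeCM.Adelic HodgeCM.PerL34 HodgeCM.Model.HypCensus HodgeCM.Model.ArchSideTerm HodgeCM.Model.ThetaDistFin HodgeCM.Model.TowerCarrier
open HodgeCM.Model.SupplyInstance HodgeCM.Model.SupplyResidual HodgeCM.Model.ThetaSpace
open HodgeCM.Model.SupplyResidual.WeilPairData (charInv)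

namespace HodgeCM.Model
namespace ThetaAdelicSide

section Honest

variable (hHD : exists_isReal_hodgeModel) (hI : hodgePQ_independent_of_hodgeModel)
  (h₁ : BallQuotientUniformised) (h₃ : CMAbelianVarietyRealised) (hA : Arapura2012_Cor_15_4_6)
variable {L : CMField} {ι₁ : L →+* ℂ} (V : HermSpace3 L ι₁) (c : SeesawCtx L)
  (hGR : (cmSplittingDatum (L : Type) finProdFinEquiv (frameD V) (frameD_real V) (frameD_ne V) (dW c.D) (dW_real c.D)
    (dW_ne c.D)).CompatibleSplitting)
  (hGR₀ : (cmSplittingDatum (L : Type) (e₁) (frameD V) (frameD_real V) (frameD_ne V) (lineVec (L : Type) (dW c.D 0))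
    (fun _ => dW_real c.D 0) (fun _ => dW_ne c.D 0)).CompatibleSplitting)
  (hGR₁ : (cmSplittingDatum (L : Type) (e₁) (frameD V) (frameD_real V) (frameD_ne V) (lineVec (L : Type) (dW c.D 1))
    (fun _ => dW_real c.D 1) (fun _ => dW_ne c.D 1)).CompatibleSplitting)
  (hGR₂ : (cmSplittingDatum (L : Type) (e₁) (frameD V) (frameD_real V) (frameD_ne V) (lineVec (L : Type) (dW' c.D 0))
    (fun _ => dW'_real c.D 0) (fun _ => dW'_ne c.D 0)).CompatibleSplitting)
  (hGR₃ : (cmSplittingDatum (L : Type) (e₁) (frameD V) (frameD_real V) (frameD_ne V) (lineVec (L : Type) (dW' c.D 1))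
    (fun _ => dW'_real c.D 1) (fun _ => dW'_ne c.D 1)).CompatibleSplitting)
  (η : CMAdelic (L : Type) (frameD V) × CMAdelic (L : Type) (dW c.D) →* ℂˣ)
  (hη : ∀ γU ∈ CMRat (L : Type) (frameD V), ∀ γ ∈ CMRat (L : Type) (dW c.D), η (γU, γ) = 1)
  (hηc : Continuous fun p => ((η p : ℂˣ) : ℂ))
  (h₁W : (∀ j, 0 < (ι₁ (dW c.D j)).re) ∨ ∀ j, (ι₁ (dW c.D j)).re < 0)
  (A : ∀ k : Fin 4, ArchLineInput V (lineRepD V c.D hGR hGR₀ hGR₁ hGR₂ hGR₃ η k))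
  (hV : IsAnisotropic L V.Hm)

variable
  (Φ₀ : Module.Dual ℂ (Fin 2 → ℂ) →ₗ[ℂ] 𝓢((Fin 3 → mixedSpace (↥(maximalRealSubfield L))), ℂ))
  (harm₀ : ∀ (u : ↥(stabilizer U21 x₀)) (ℓ : Module.Dual ℂ (Fin 2 → ℂ)),
    lineOmega_zero V c.D hGR hGR₀ hGR₁ (eta₀ V c.D η) (u : U21) (Φ₀ ℓ) =
      Φ₀ ((BallForms.isPullbackCocycle_cotangentCocycle.weightOf x₀).dual u ℓ))
  (hdef₀ : ∀ a : UnitaryGroup.arch (↥(maximalRealSubfield L)) L (IsCMField.complexConj L) 3 V.Hm,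
    UnitaryGroup.archAt (↥(maximalRealSubfield L)) L (IsCMField.complexConj L) 3 V.Hm (UnitaryGroup.cmPlace (L : Type) ι₁)
        (NumberField.complexConj_smul_infinitePlace (L : Type) _) (IsCMField.complexConj_ne_one (L : Type)) a = 1 →
    ∀ (ℓ : Module.Dual ℂ (Fin 2 → ℂ)) (Φf : FinSB (↥(maximalRealSubfield L)) (Fin 3)),
      lineRepOf V c.D hGR hGR₀ hGR₁ hGR₂ hGR₃ (eta₀ V c.D η) (eta₁ V c.D η) (eta₂ V c.D η) (eta₃ V c.D η) 0
          (HodgeCM.Adelic.regimeEquiv L V.Hm hV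
            (UnitaryGroup.archToAdelic (↥(maximalRealSubfield L)) L (IsCMField.complexConj L) 3 V.Hm a), 1)
          (piSchwartzBruhatEquiv (↥(maximalRealSubfield L)) (Fin 3) (Φ₀ ℓ ⊗ₜ[ℂ] Φf)) =
        piSchwartzBruhatEquiv (↥(maximalRealSubfield L)) (Fin 3) (Φ₀ ℓ ⊗ₜ[ℂ] Φf))
  (Φ₁ : Module.Dual ℂ (Fin 2 → ℂ) →ₗ[ℂ] 𝓢((Fin 3 → mixedSpace (↥(maximalRealSubfield L))), ℂ))
  (harm₁ : ∀ (u : ↥(stabilizer U21 x₀)) (ℓ : Module.Dual ℂ (Fin 2 → ℂ)),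
    lineOmega_one V c.D hGR hGR₀ hGR₁ (eta₁ V c.D η) (u : U21) (Φ₁ ℓ) =
      Φ₁ ((BallForms.isPullbackCocycle_cotangentCocycle.weightOf x₀).dual u ℓ))
  (hdef₁ : ∀ a : UnitaryGroup.arch (↥(maximalRealSubfield L)) L (IsCMField.complexConj L) 3 V.Hm,
    UnitaryGroup.archAt (↥(maximalRealSubfield L)) L (IsCMField.complexConj L) 3 V.Hm (UnitaryGroup.cmPlace (L : Type) ι₁)
        (NumberField.complexConj_smul_infinitePlace (L : Type) _) (IsCMField.complexConj_ne_one (L : Type)) a = 1 →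
    ∀ (ℓ : Module.Dual ℂ (Fin 2 → ℂ)) (Φf : FinSB (↥(maximalRealSubfield L)) (Fin 3)),
      lineRepOf V c.D hGR hGR₀ hGR₁ hGR₂ hGR₃ (eta₀ V c.D η) (eta₁ V c.D η) (eta₂ V c.D η) (eta₃ V c.D η) 1
          (HodgeCM.Adelic.regimeEquiv L V.Hm hV
            (UnitaryGroup.archToAdelic (↥(maximalRealSubfield L)) L (IsCMField.complexConj L) 3 V.Hm a), 1)
          (piSchwartzBruhatEquiv (↥(maximalRealSubfield L)) (Fin 3) (Φ₁ ℓ ⊗ₜ[ℂ] Φf)) =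
        piSchwartzBruhatEquiv (↥(maximalRealSubfield L)) (Fin 3) (Φ₁ ℓ ⊗ₜ[ℂ] Φf))

/-- **`hrk` OF SLOT 0 IS A THEOREM**: the admissible archimedean families of the honest (J4) datum of slot 0, relative to the slot's
archimedean operators `archOpZero`, have `ℂ`-rank at most one (#CA64 `rank_le_one_of_lineOmega_zero`). -/
theorem rank_admFamilies_thetaDistDatumZeroOf_le_one :
    Module.rank ℂ ↥((thetaDistDatumZeroOf V c hGR hGR₀ hGR₁ hGR₂ hGR₃ η hη hηc h₁W A hV Φ₀ harm₀ hdef₀).admFamilies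
      (archOpZero V c hGR hGR₀ hGR₁ η)) ≤ 1 :=
  rank_le_one_of_lineOmega_zero V c.D hGR hGR₀ hGR₁ hGR₂ hGR₃ (eta₀ V c.D η) (eta₁ V c.D η) (eta₂ V c.D η) (eta₃ V c.D η) hV
    (archOpZero V c hGR hGR₀ hGR₁ η) _
    (fun aa _ => archSideOf_ω_zero_regime_archToAdelic V c hGR hGR₀ hGR₁ hGR₂ hGR₃ η hη hηc h₁W A hV aa)
    (fun _ ha => ha.1) (fun _ ha => ha.2)

/-- **`hrk` OF SLOT 1 IS A THEOREM** (#CA64 `rank_le_one_of_lineOmega_one`). -/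
theorem rank_admFamilies_thetaDistDatumOneOf_le_one :
    Module.rank ℂ ↥((thetaDistDatumOneOf V c hGR hGR₀ hGR₁ hGR₂ hGR₃ η hη hηc h₁W A hV Φ₁ harm₁ hdef₁).admFamilies
      (archOpOne V c hGR hGR₀ hGR₁ η)) ≤ 1 :=
  rank_le_one_of_lineOmega_one V c.D hGR hGR₀ hGR₁ hGR₂ hGR₃ (eta₀ V c.D η) (eta₁ V c.D η) (eta₂ V c.D η) (eta₃ V c.D η) hV
    (archOpOne V c hGR hGR₀ hGR₁ η) _
    (fun aa _ => archSideOf_ω_one_regime_archToAdelic V c hGR hGR₀ hGR₁ hGR₂ hGR₃ η hη hηc h₁W A hV aa)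
    (fun _ ha => ha.1) (fun _ ha => ha.2)

variable
  (hd₀ : ∀ (T : 𝓢((Fin 3 → mixedSpace (↥(maximalRealSubfield L))), ℂ) →L[ℂ] ℂ) (ℓ : Module.Dual ℂ (Fin 2 → ℂ)),
    DifferentiableAt ℝ (fun b => T (lineOmega_zero V c.D hGR hGR₀ hGR₁ (eta₀ V c.D η) (BallForms.expP b) (Φ₀ ℓ))) 0)
  (hCR₀ : ∀ (T : 𝓢((Fin 3 → mixedSpace (↥(maximalRealSubfield L))), ℂ) →L[ℂ] ℂ) (ℓ : Module.Dual ℂ (Fin 2 → ℂ)) (v : Fin 2 → ℂ),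
    fderiv ℝ (fun b => T (lineOmega_zero V c.D hGR hGR₀ hGR₁ (eta₀ V c.D η) (BallForms.expP b) (Φ₀ ℓ))) 0 (Complex.I • v) =
      Complex.I • fderiv ℝ (fun b => T (lineOmega_zero V c.D hGR hGR₀ hGR₁ (eta₀ V c.D η) (BallForms.expP b) (Φ₀ ℓ))) 0 v)
  (hd₁ : ∀ (T : 𝓢((Fin 3 → mixedSpace (↥(maximalRealSubfield L))), ℂ) →L[ℂ] ℂ) (ℓ : Module.Dual ℂ (Fin 2 → ℂ)),
    DifferentiableAt ℝ (fun b => T (lineOmega_one V c.D hGR hGR₀ hGR₁ (eta₁ V c.D η) (BallForms.expP b) (Φ₁ ℓ))) 0)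
  (hCR₁ : ∀ (T : 𝓢((Fin 3 → mixedSpace (↥(maximalRealSubfield L))), ℂ) →L[ℂ] ℂ) (ℓ : Module.Dual ℂ (Fin 2 → ℂ)) (v : Fin 2 → ℂ),
    fderiv ℝ (fun b => T (lineOmega_one V c.D hGR hGR₀ hGR₁ (eta₁ V c.D η) (BallForms.expP b) (Φ₁ ℓ))) 0 (Complex.I • v) =
      Complex.I • fderiv ℝ (fun b => T (lineOmega_one V c.D hGR hGR₀ hGR₁ (eta₁ V c.D η) (BallForms.expP b) (Φ₁ ℓ))) 0 v)
  {𝓕 : Set C(↥(relNormOneIdeles (↥(maximalRealSubfield L)) L) ⧸ relNormOneRat (↥(maximalRealSubfield L)) L, ℂ)}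
  (h𝓕 : ∀ f ∈ 𝓕, ∃ χ : PontryaginDual (↥(relNormOneIdeles (↥(maximalRealSubfield L)) L) ⧸ relNormOneRat (↥(maximalRealSubfield L)) L),
    f = charInv χ)

include hd₀ hCR₀ h𝓕 in
/-- **#R124's end statement for slot 0 WITHOUT the multiplicity-one hypothesis**: the `U`-level class of every saturated hol-germ
theta form of slot 0 of the honest side lies in the supremum of the coinvariant blocks (`…_of_rank_le_one` with `hrk` :=
`rank_admFamilies_thetaDistDatumZeroOf_le_one`). -/
theorem clsU_mem_iSup_block_of_mem_holSat_archSideOf_zero_of_ne_zero (hΦ : Φ₀ ≠ 0)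
    (hι : (archSideOf V c hGR hGR₀ hGR₁ hGR₂ hGR₃ η hη hηc h₁W A).ιinf = archInfOf V) (Γ : Level V)
    {F : (V.latticeModel printFact_unitaryCompact_holds).G → (Fin 2 → ℂ)}
    (hF : F ∈ (archSideOf V c hGR hGR₀ hGR₁ hGR₂ hGR₃ η hη hηc h₁W A).holSat hV 0 Γ 𝓕) :
    ∃ hF' : F ∈ (archSideOf V c hGR hGR₀ hGR₁ hGR₂ hGR₃ η hη hηc h₁W A).holSatU hV 0 𝓕,
      (archSideOf V c hGR hGR₀ hGR₁ hGR₂ hGR₃ η hη hηc h₁W A).clsU hHD hI h₁ h₃ hA 𝓕 hι hV 0 ⟨F, hF'⟩ ∈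
        ⨆ (χ : PontryaginDual (↥(relNormOneIdeles (↥(maximalRealSubfield L)) L) ⧸ relNormOneRat (↥(maximalRealSubfield L)) L))
          (_ : charInv χ ∈ 𝓕),
          ⨆ ψ : ((thetaDistDatumZeroOf V c hGR hGR₀ hGR₁ hGR₂ hGR₃ η hη hηc h₁W A hV Φ₀ harm₀ hdef₀).coinvRep χ).asModule
              →ₗ[MonoidAlgebra ℂ ↥V.adelicFin] Tower hHD hI (ballQuotientUniformisedDatum_of h₁) h₃ hA V,
            (LinearMap.range ψ).restrictScalars ℂ :=
  clsU_mem_iSup_block_of_mem_holSat_archSideOf_zero_of_rank_le_one hHD hI h₁ h₃ hA V c hGR hGR₀ hGR₁ hGR₂ hGR₃ η hη hηc h₁W A hV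
    Φ₀ harm₀ hdef₀ hd₀ hCR₀ h𝓕 hΦ
    (rank_admFamilies_thetaDistDatumZeroOf_le_one V c hGR hGR₀ hGR₁ hGR₂ hGR₃ η hη hηc h₁W A hV Φ₀ harm₀ hdef₀) hι Γ hF

include hd₁ hCR₁ h𝓕 in
/-- **#R124's end statement for slot 1 WITHOUT the multiplicity-one hypothesis.** -/
theorem clsU_mem_iSup_block_of_mem_holSat_archSideOf_one_of_ne_zero (hΦ : Φ₁ ≠ 0)
    (hι : (archSideOf V c hGR hGR₀ hGR₁ hGR₂ hGR₃ η hη hηc h₁W A).ιinf = archInfOf V) (Γ : Level V)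
    {F : (V.latticeModel printFact_unitaryCompact_holds).G → (Fin 2 → ℂ)}
    (hF : F ∈ (archSideOf V c hGR hGR₀ hGR₁ hGR₂ hGR₃ η hη hηc h₁W A).holSat hV 1 Γ 𝓕) :
    ∃ hF' : F ∈ (archSideOf V c hGR hGR₀ hGR₁ hGR₂ hGR₃ η hη hηc h₁W A).holSatU hV 1 𝓕,
      (archSideOf V c hGR hGR₀ hGR₁ hGR₂ hGR₃ η hη hηc h₁W A).clsU hHD hI h₁ h₃ hA 𝓕 hι hV 1 ⟨F, hF'⟩ ∈
        ⨆ (χ : PontryaginDual (↥(relNormOneIdeles (↥(maximalRealSubfield L)) L) ⧸ relNormOneRat (↥(maximalRealSubfield L)) L))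
          (_ : charInv χ ∈ 𝓕),
          ⨆ ψ : ((thetaDistDatumOneOf V c hGR hGR₀ hGR₁ hGR₂ hGR₃ η hη hηc h₁W A hV Φ₁ harm₁ hdef₁).coinvRep χ).asModule
              →ₗ[MonoidAlgebra ℂ ↥V.adelicFin] Tower hHD hI (ballQuotientUniformisedDatum_of h₁) h₃ hA V,
            (LinearMap.range ψ).restrictScalars ℂ :=
  clsU_mem_iSup_block_of_mem_holSat_archSideOf_one_of_rank_le_one hHD hI h₁ h₃ hA V c hGR hGR₀ hGR₁ hGR₂ hGR₃ η hη hηc h₁W A hV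
    Φ₁ harm₁ hdef₁ hd₁ hCR₁ h𝓕 hΦ
    (rank_admFamilies_thetaDistDatumOneOf_le_one V c hGR hGR₀ hGR₁ hGR₂ hGR₃ η hη hηc h₁W A hV Φ₁ harm₁ hdef₁) hι Γ hF

end Honest

end ThetaAdelicSide
end HodgeCM.Model
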